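import Summits.AtomisticToContinuum.Crystallization.Theorems.FrustratedLawDichotomyStrainedPatchHomCurvLeafHCC

/-!
# SYMMETRISED READ for hcp tree verdicts: bisect only the SIX upper-triangle entry coordinates (BUDGET-F lever L0)

decomp-a2c hand-1 g28 (crux `AperiodicFrustratedLawGap`, stmt-AtomisticToContinuum-27623; `(H) HomFloor (1/625)`, hcp half; hand-1 g28 BUDGET-F §1
L0).  `…HomEntryGram.asymPair` prunes only STRICTLY disjoint mirrored entry intervals, so a 12-coordinate driver that bisects both `(a,b)` and `(b,a)`
keeps every corner-touching pair of children (up to ×3 per off-diagonal pair per level).  The fcc PlanCore instead bisects the upper triangle only and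
READS the lower triangle from its mirror.  This file gives the hcp verdicts the same device: for any verdict `v` sound in the generic hver shape of
`…HomEntryFlipHcp.hcpHalf_of_entryTreeShuf`, the verdict `symV v c w := v (mirU c) (mirU w)` (lower-triangle centre/half-width := the mirrored upper
datum) is sound in the same shape — because the hver hypotheses include self-adjointness, `U_ab = U_ba`.  A driver may then leave the three lower
coordinates at root width forever and bisect only `(a,b)` with `a ≤ b` (+ the three shuffles): 9 bisected coordinates instead of 12.

* §1 `mirU`, `symV`, `entry_symm` (`(U e_b)_a = (U e_a)_b` for self-adjoint `U`), ★ `symV_sound`;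
* §2 ★★ `hcpHalf_of_entryTreeSym` (generic) and the instance `hcpHalf_of_entryTreeHCCXs` for `symV (entryLeafOKHCCX μ)`.

Two kernel definitions + soundness; 0 sorry; standard axioms; no instances / notation / `#eval`.  `--supports stmt-AtomisticToContinuum-27623`.
-/

noncomputable section

namespace Summit.AtomisticToContinuum.Crystallization.Theorems.FrustratedLawDichotomyStrainedPatchHomSymRead

open scoped BigOperators RealInnerProductSpace
open Literature.Analysis.ValidatedNumerics.Numerics
open Summit.AtomisticToContinuum.Crystallization.Theorems.ChargedEnergyGapNegative (E3)
open Summit.AtomisticToContinuum.Crystallization.Theorems.FrustratedLawDichotomySchurCut (effPot w₄₅ ω₄)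
open Summit.AtomisticToContinuum.Crystallization.Theorems.FrustratedLawDichotomyAveragingRuleTightFree (TightNearCap BadNearCap)
open Summit.AtomisticToContinuum.Crystallization.Theorems.FrustratedLawDichotomyExemptAbsorption (ExemptNear)
open Summit.AtomisticToContinuum.Crystallization.Theorems.FrustratedLawDichotomyStrainedPatchHomSplit
open Summit.AtomisticToContinuum.Crystallization.Theorems.FrustratedLawDichotomyStrainedPatchHomEntryGramHcp (rootCH rootWH)
open Summit.AtomisticToContinuum.Crystallization.Theorems.FrustratedLawDichotomyStrainedPatchHomCertTree (CertTree treeOK)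
open Summit.AtomisticToContinuum.Crystallization.Theorems.FrustratedLawDichotomyStrainedPatchHomEntryFlipHcp (HcpDich hcpHalf_of_entryTreeShuf)
open Summit.AtomisticToContinuum.Crystallization.Theorems.FrustratedLawDichotomyStrainedPatchHomCurvLeafHCC (entryLeafOKHCCX entryLeafOKHCCX_sound)

/-! ## §1. The mirrored read and its soundness -/

/-- Read the lower-triangle entry data `(a,b)`, `b < a`, from the mirrored upper datum `(b,a)`; shuffle data unchanged. -/
def mirU (f : (Fin 3 × Fin 3) ⊕ Fin 3 → ℤ) : (Fin 3 × Fin 3) ⊕ Fin 3 → ℤ :=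
  Sum.elim (fun ab => if ab.1 ≤ ab.2 then f (Sum.inl ab) else f (Sum.inl (ab.2, ab.1))) (fun i => f (Sum.inr i))

/-- ★ The symmetrised verdict: evaluate `v` on the mirrored box. -/
def symV (v : ((Fin 3 × Fin 3) ⊕ Fin 3 → ℤ) → ((Fin 3 × Fin 3) ⊕ Fin 3 → ℤ) → Bool) (c w : (Fin 3 × Fin 3) ⊕ Fin 3 → ℤ) : Bool :=
  v (mirU c) (mirU w)

/-- Entries of a self-adjoint map are symmetric: `(U e_b)_a = (U e_a)_b`. [folklore] -/
theorem entry_symm (U : E3 →L[ℝ] E3) (hsa : ∀ v v' : E3, ⟪U v, v'⟫ = ⟪v, U v'⟫) (a b : Fin 3) :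
    (U (EuclideanSpace.single b (1 : ℝ))) a = (U (EuclideanSpace.single a (1 : ℝ))) b := by
  have h1 : (U (EuclideanSpace.single b (1 : ℝ))) a = ⟪U (EuclideanSpace.single b (1 : ℝ)), EuclideanSpace.single a (1 : ℝ)⟫ := by
    rw [EuclideanSpace.inner_single_right]; simp
  have h2 : (U (EuclideanSpace.single a (1 : ℝ))) b = ⟪EuclideanSpace.single b (1 : ℝ), U (EuclideanSpace.single a (1 : ℝ))⟫ := by
    rw [EuclideanSpace.inner_single_left]; simp
  rw [h1, h2, hsa]

/-- ★ **SOUNDNESS OF THE SYMMETRISED READ**: a verdict sound in the generic hver shape stays sound after `symV`. [folklore] -/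
theorem symV_sound {μ : ℤ} (v : ((Fin 3 × Fin 3) ⊕ Fin 3 → ℤ) → ((Fin 3 × Fin 3) ⊕ Fin 3 → ℤ) → Bool)
    (hver : ∀ c w, v c w = true → ∀ (U : E3 →L[ℝ] E3) (ξ : E3), (∀ x x' : E3, ⟪U x, x'⟫ = ⟪x, U x'⟫) → ‖U - 1‖ ≤ 1 / 4 →
      (∀ ab : Fin 3 × Fin 3, |(U (EuclideanSpace.single ab.2 (1 : ℝ))) ab.1 - (c (Sum.inl ab) : ℝ) / SC| ≤ (w (Sum.inl ab) : ℝ) / SC) →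
      (∀ i : Fin 3, |ξ i - (c (Sum.inr i) : ℝ) / SC| ≤ (w (Sum.inr i) : ℝ) / SC) → 0 ≤ ξ 0 → 0 ≤ ξ 2 →
      (∀ (M : ℕ) (z : Fin M → E3) (cc : Fin M), Function.Injective z →
          Set.range z = {x : E3 | dist x (z cc) ≤ 133 / 10 ∧ ∃ a : Fin 3 → ℤ,
            x = z cc + latPt U hexFrame a ∨ x = z cc + latPt U hexFrame a + U (hcpShift + ξ)} →
          TightNearCap (9 / 5) (3 / 2) z cc ∨ ExemptNear (9 / 5) ExRec z cc ∨ BadNearCap (9 / 5) (3 / 2) z cc) ∨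
        (μ : ℝ) / SC ≤ ∑ b ∈ (Fintype.piFinset fun _ : Fin 3 => Finset.Icc (-7 : ℤ) 7).filter (fun b => b ≠ 0), effPot w₄₅ ω₄ (3 / 400) ‖latPt U hexFrame b‖ +
          ∑ b ∈ (Fintype.piFinset fun _ : Fin 3 => Finset.Icc (-7 : ℤ) 7), effPot w₄₅ ω₄ (3 / 400) ‖latPt U hexFrame b + U (hcpShift + ξ)‖)
    (c w : (Fin 3 × Fin 3) ⊕ Fin 3 → ℤ) (h : symV v c w = true) (U : E3 →L[ℝ] E3) (ξ : E3) (hsa : ∀ x x' : E3, ⟪U x, x'⟫ = ⟪x, U x'⟫)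
    (hU : ‖U - 1‖ ≤ 1 / 4)
    (hbox : ∀ ab : Fin 3 × Fin 3, |(U (EuclideanSpace.single ab.2 (1 : ℝ))) ab.1 - (c (Sum.inl ab) : ℝ) / SC| ≤ (w (Sum.inl ab) : ℝ) / SC)
    (hξ : ∀ i : Fin 3, |ξ i - (c (Sum.inr i) : ℝ) / SC| ≤ (w (Sum.inr i) : ℝ) / SC) (h0 : 0 ≤ ξ 0) (h2 : 0 ≤ ξ 2) :
    (∀ (M : ℕ) (z : Fin M → E3) (cc : Fin M), Function.Injective z →
        Set.range z = {x : E3 | dist x (z cc) ≤ 133 / 10 ∧ ∃ a : Fin 3 → ℤ,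
          x = z cc + latPt U hexFrame a ∨ x = z cc + latPt U hexFrame a + U (hcpShift + ξ)} →
        TightNearCap (9 / 5) (3 / 2) z cc ∨ ExemptNear (9 / 5) ExRec z cc ∨ BadNearCap (9 / 5) (3 / 2) z cc) ∨
      (μ : ℝ) / SC ≤ ∑ b ∈ (Fintype.piFinset fun _ : Fin 3 => Finset.Icc (-7 : ℤ) 7).filter (fun b => b ≠ 0), effPot w₄₅ ω₄ (3 / 400) ‖latPt U hexFrame b‖ +
        ∑ b ∈ (Fintype.piFinset fun _ : Fin 3 => Finset.Icc (-7 : ℤ) 7), effPot w₄₅ ω₄ (3 / 400) ‖latPt U hexFrame b + U (hcpShift + ξ)‖ := by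
  refine hver (mirU c) (mirU w) h U ξ hsa hU (fun ab => ?_) (fun i => by simpa [mirU] using hξ i) h0 h2
  rcases ab with ⟨a, b⟩
  by_cases hab : a ≤ b
  · simpa [mirU, hab] using hbox (a, b)
  · have e := entry_symm U hsa a b
    simp only [mirU, Sum.elim_inl, hab, ↓reduceIte]
    rw [e]
    exact hbox (b, a)

/-! ## §2. The hcp half over a symmetrised verdict -/

/-- ★★ **THE hcp HALF FROM ONE TREE OVER A SYMMETRISED VERDICT** (only the upper-triangle entry coordinates and the shuffles need bisecting).
[folklore chaining: `…HomEntryFlipHcp.hcpHalf_of_entryTreeShuf`] -/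
theorem hcpHalf_of_entryTreeSym {m : ℝ} {μ : ℤ} (hμ : 2 * (m + (-(7175 / 10000) + 3 / 400)) * SC ≤ μ)
    (v : ((Fin 3 × Fin 3) ⊕ Fin 3 → ℤ) → ((Fin 3 × Fin 3) ⊕ Fin 3 → ℤ) → Bool)
    (hver : ∀ c w, v c w = true → ∀ (U : E3 →L[ℝ] E3) (ξ : E3), (∀ x x' : E3, ⟪U x, x'⟫ = ⟪x, U x'⟫) → ‖U - 1‖ ≤ 1 / 4 →
      (∀ ab : Fin 3 × Fin 3, |(U (EuclideanSpace.single ab.2 (1 : ℝ))) ab.1 - (c (Sum.inl ab) : ℝ) / SC| ≤ (w (Sum.inl ab) : ℝ) / SC) →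
      (∀ i : Fin 3, |ξ i - (c (Sum.inr i) : ℝ) / SC| ≤ (w (Sum.inr i) : ℝ) / SC) → 0 ≤ ξ 0 → 0 ≤ ξ 2 →
      (∀ (M : ℕ) (z : Fin M → E3) (cc : Fin M), Function.Injective z →
          Set.range z = {x : E3 | dist x (z cc) ≤ 133 / 10 ∧ ∃ a : Fin 3 → ℤ,
            x = z cc + latPt U hexFrame a ∨ x = z cc + latPt U hexFrame a + U (hcpShift + ξ)} →
          TightNearCap (9 / 5) (3 / 2) z cc ∨ ExemptNear (9 / 5) ExRec z cc ∨ BadNearCap (9 / 5) (3 / 2) z cc) ∨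
        (μ : ℝ) / SC ≤ ∑ b ∈ (Fintype.piFinset fun _ : Fin 3 => Finset.Icc (-7 : ℤ) 7).filter (fun b => b ≠ 0), effPot w₄₅ ω₄ (3 / 400) ‖latPt U hexFrame b‖ +
          ∑ b ∈ (Fintype.piFinset fun _ : Fin 3 => Finset.Icc (-7 : ℤ) 7), effPot w₄₅ ω₄ (3 / 400) ‖latPt U hexFrame b + U (hcpShift + ξ)‖)
    {t : CertTree ((Fin 3 × Fin 3) ⊕ Fin 3)} (h : treeOK (symV v) t rootCH rootWH = true) :
    ∀ (U : E3 →L[ℝ] E3) (ξ : E3), (∀ x w : E3, inner ℝ (U x) w = inner ℝ x (U w)) → (∀ w : E3, 0 ≤ inner ℝ w (U w)) →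
      ‖U - 1‖ ≤ 1 / 4 → ‖ξ‖ ≤ 1 / 4 → HcpDich m U ξ :=
  hcpHalf_of_entryTreeShuf hμ (symV v) (fun c w hv U ξ hsa hU hbox hξ h0 h2 => symV_sound v hver c w hv U ξ hsa hU hbox hξ h0 h2) h

/-- ★ Instance: the hcp half from ONE tree over `symV (entryLeafOKHCCX μ)` (centred-slope ξ-convexity verdict ∨ exempt/quick verdicts, symmetrised read).
[folklore chaining] -/
theorem hcpHalf_of_entryTreeHCCXs {m : ℝ} {μ : ℤ} (hμ : 2 * (m + (-(7175 / 10000) + 3 / 400)) * SC ≤ μ) {t : CertTree ((Fin 3 × Fin 3) ⊕ Fin 3)}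
    (h : treeOK (symV (entryLeafOKHCCX μ)) t rootCH rootWH = true) :
    ∀ (U : E3 →L[ℝ] E3) (ξ : E3), (∀ x w : E3, inner ℝ (U x) w = inner ℝ x (U w)) → (∀ w : E3, 0 ≤ inner ℝ w (U w)) →
      ‖U - 1‖ ≤ 1 / 4 → ‖ξ‖ ≤ 1 / 4 → HcpDich m U ξ :=
  hcpHalf_of_entryTreeSym hμ (entryLeafOKHCCX μ) (fun _ _ hv U ξ hsa hU hbox hξ h0 h2 => entryLeafOKHCCX_sound hv U ξ hsa hU hbox hξ h0 h2) h

end Summit.AtomisticToContinuum.Crystallization.Theorems.FrustratedLawDichotomyStrainedPatchHomSymRead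

end
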